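import Mathlib
import Literature.NumberTheory.LFunctions.Zhang2022.TypedSection17Identities
import HarnessLib

/-!
# Zhang (2022) §17 p. 96, node `Z22:§17.u006` in the `N`-coefficient reading: `Step17_u006N` HOLDS

Topic `Literature/NumberTheory/LFunctions/Zhang2022` (Landau–Siegel audit tree; verdict-neutral).
Y. Zhang, *Discrete mean estimates and the Landau–Siegel zero*, arXiv:2211.02515v1 (2022)
[Zhang2022LandauSiegel] — **an unrefereed manuscript under adjudication; nothing in this file asserts
or denies its Theorems 1–2.** §17 p. 96 (tex L4732), DAG node `Z22:§17.u006`: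

> Note that for `n < D⁴`,
> `ν*(n) = Σ_{n=n₁⋯n₆} κ₂(n₁)χ(n₂n₃)(ϰ₁(n₂)+ι₂ϰ₂(n₂))(ῑ₃ϰ₃(n₃)+ῑ₄ϰ₄(n₃))υ(n₄)g̃₂(n₅)g̃₃(n₆)`.

As printed (`Typed.Section17.Step17_u006`) the last two factors are the `K`-coefficients
`g̃_j(y) = y^{β_j}g*(P₄/y)` of §§15–16, whereas the factors of `𝔨₃` are `N(s+β₂,ψ)N(s+β₃,ψ)` with
coefficients `n^{−β_j}g*(T²/n)` (§6); the cell siegel-zhang filed this as GAP row **G-L4t6-2**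
(«printed-false-pointwise (LOCAL, harmless) … discharge lane uses `Step17_u006N`; no adjudication
needed») and typed the `N`-coefficient READING `Typed.Section17.Step17_u006N` alongside. This file
PROVES that reading, for every modulus `D` and every character `χ` (no largeness, no Assumption (A)):

* `step17_u006N_holds : Step17_u006N c' χ` — for `1 ≤ n < D⁴`,
  `ν*(n) = (κ₂ ∗ [χ(ϰ₁+ι₂ϰ₂)] ∗ [χ(ῑ₃ϰ₃+ῑ₄ϰ₄)] ∗ υ ∗ nN β₂ ∗ nN β₃)(n)`.

The typed `ν* = κ₂ ∗ (bχ) ∗ υ·[≤D⁴] ∗ nN β₂ ∗ nN β₃` (`Typed.Section17.nuStar`) differs from the right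
side only by bookkeeping that is invisible at arguments `n < D⁴`: (i) `b·χ = [χ(ϰ₁·[<P^{1/2}]+ι₂ϰ₂)] ∗
[χ(ῑ₃ϰ₃+ῑ₄ϰ₂)]` (`bcoef_eq_conv`, `χ` completely multiplicative; `ϰ₄ := ϰ₂` is the typed reading
`vk4`); (ii) the cut `[n₂ < P^{1/2}]` on `ϰ₁` never bites below `D⁴` (`vk1_cut_eq_of_lt`: for `D ≥ 4`,
`D⁴ ≤ P^{1/2} = e^{𝓛⁹/2}`; for `D ≤ 3` the explicit sizes `P₁ = e^{0.504𝓛⁹}`, `e^{1.091} < 3`,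
`log 3 < 1.1037` show that every integer `≥ P^{1/2}` is already `≥ P₁`, where `ϰ₁` vanishes);
(iii) the truncation `υ·[≤D⁴]` agrees with `υ` at every divisor of `n < D⁴`; (iv) Dirichlet
convolution is associative and its value at `n` only depends on the values of the factors at the
divisors of `n` (`convolution_apply_congr_of_lt`).

Theorems only: no definition, no claim node, no named fact; axioms standard. WHAT THIS IS NOT: a proof
of the printed `Step17_u006` (false as an exact identity), of §17.u007 ("a detailed analysis shows"), or
of anything about Theorems 1–2 of the source or Landau–Siegel zeros.

## References

* Y. Zhang, arXiv:2211.02515v1 (2022), §17 p. 96 (u006), tex L4732; §6 p. 30 (`N(s,ψ)`, `g*`); §8 (8.6)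
  (`ϰ_j`); §15 (15.1) (`b`). [cite: Zhang2022LandauSiegel, §17 u006 p.96]
-/

noncomputable section

open Complex Real ComplexConjugate
open scoped LSeries.notation

namespace Literature.NumberTheory.LFunctions.Zhang2022.Typed.Section17

open Literature.NumberTheory.LFunctions.Zhang2022
open Literature.NumberTheory.LFunctions.Zhang2022.Skeleton

/-! ## Generic bookkeeping on Dirichlet convolution -/

/-- Dirichlet convolution of sequences is associative (it is the multiplication of the arithmetic
functions the sequences define). [folklore] -/
private theorem convolution_assoc (f g h : ℕ → ℂ) : (f ⍟ g) ⍟ h = f ⍟ (g ⍟ h) := by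
  show ⇑(toArithmeticFunction ⇑(toArithmeticFunction f * toArithmeticFunction g) *
        toArithmeticFunction h) =
      ⇑(toArithmeticFunction f *
        toArithmeticFunction ⇑(toArithmeticFunction g * toArithmeticFunction h))
  rw [ArithmeticFunction.toArithmeticFunction_eq_self,
    ArithmeticFunction.toArithmeticFunction_eq_self, mul_assoc]

/-- Locality of Dirichlet convolution: the value `(f ∗ g)(n)` for `0 < n < N` only depends on the
values of `f` and `g` at the positive integers `< N`. [folklore] -/
private theorem convolution_apply_congr_of_lt {N : ℕ} {f f' g g' : ℕ → ℂ}
    (hf : ∀ m : ℕ, m ≠ 0 → m < N → f m = f' m) (hg : ∀ m : ℕ, m ≠ 0 → m < N → g m = g' m) :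
    ∀ n : ℕ, n ≠ 0 → n < N → (f ⍟ g) n = (f' ⍟ g') n := by
  intro n hn0 hn
  rw [LSeries.convolution_def, LSeries.convolution_def]
  refine Finset.sum_congr rfl fun p hp => ?_
  obtain ⟨hpn, -⟩ := Nat.mem_divisorsAntidiagonal.mp hp
  have h1 : p.1 ≠ 0 := by
    rintro h; rw [h, zero_mul] at hpn; exact hn0 hpn.symm
  have h2 : p.2 ≠ 0 := by
    rintro h; rw [h, mul_zero] at hpn; exact hn0 hpn.symm
  have hp1 : p.1 ≤ n := by
    rw [← hpn]; exact Nat.le_mul_of_pos_right _ (Nat.pos_of_ne_zero h2)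
  have hp2 : p.2 ≤ n := by
    rw [← hpn]; exact Nat.le_mul_of_pos_left _ (Nat.pos_of_ne_zero h1)
  rw [hf p.1 h1 (lt_of_le_of_lt hp1 hn), hg p.2 h2 (lt_of_le_of_lt hp2 hn)]

/-- Twisting by a Dirichlet character (completely multiplicative on `ℕ`) commutes with Dirichlet
convolution: `(χf) ∗ (χg) = χ·(f ∗ g)`. [folklore] -/
private theorem convolution_chi_mul {D : ℕ} (χ : DirichletCharacter ℂ D) (f g : ℕ → ℂ) :
    (fun n : ℕ => χ (n : ZMod D) * f n) ⍟ (fun n : ℕ => χ (n : ZMod D) * g n) =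
      fun n : ℕ => χ (n : ZMod D) * (f ⍟ g) n := by
  rw [LSeries.convolution_def, LSeries.convolution_def]
  ext n
  rw [Finset.mul_sum]
  refine Finset.sum_congr rfl fun p hp => ?_
  have hpn : p.1 * p.2 = n := (Nat.mem_divisorsAntidiagonal.mp hp).1
  rw [← hpn, Nat.cast_mul, map_mul]
  ring

/-! ## The cut `[n < P^{1/2}]` on `ϰ₁` is invisible below `D⁴` -/

/-- `e^{1.091} < 3`, whence `1.091 < log 3`. [folklore] -/
private theorem log_three_gt : (1.091 : ℝ) < Real.log 3 := by
  rw [Real.lt_log_iff_exp_lt (by norm_num : (0 : ℝ) < 3)]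
  have h1 : Real.exp 1 < 2.7182818286 := Real.exp_one_lt_d9
  have h2 : (0.909 : ℝ) * Real.exp 0.091 ≤ 1 := by
    have h := Real.add_one_le_exp (-(0.091 : ℝ))
    rw [Real.exp_neg] at h
    have h' : (0.909 : ℝ) ≤ (Real.exp 0.091)⁻¹ := by linarith
    calc (0.909 : ℝ) * Real.exp 0.091 ≤ (Real.exp 0.091)⁻¹ * Real.exp 0.091 := by
          gcongr
      _ = 1 := inv_mul_cancel₀ (Real.exp_pos _).ne'
  have h3 : (1.091 : ℝ) = 1 + 0.091 := by norm_num
  rw [h3, Real.exp_add]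
  nlinarith [Real.exp_pos (0.091 : ℝ), Real.exp_pos (1 : ℝ)]

/-- `log 3 < 1.1037` (`log 3 = 1 + log(3/e) ≤ 1 + (3/e − 1)`, `e > 2.7182818283`). [folklore] -/
private theorem log_three_lt : Real.log 3 < (1.1037 : ℝ) := by
  have he : (2.7182818283 : ℝ) < Real.exp 1 := Real.exp_one_gt_d9
  have he0 : (0 : ℝ) < Real.exp 1 := Real.exp_pos 1
  have h1 : Real.log 3 = Real.log (3 / Real.exp 1) + 1 := by
    rw [Real.log_div (by norm_num) he0.ne', Real.log_exp]; ring
  have h2 : Real.log (3 / Real.exp 1) ≤ 3 / Real.exp 1 - 1 :=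
    Real.log_le_sub_one_of_pos (by positivity)
  have h3 : 3 / Real.exp 1 < (1.1037 : ℝ) := by
    rw [div_lt_iff₀ he0]; nlinarith
  linarith

/-- The numerical heart of the case `D = 3`: `(log 3)⁸ > 2` and `0.504(log 3)⁹ < 1.23`. [folklore] -/
private theorem log_three_pow_bounds :
    (2 : ℝ) < Real.log 3 ^ 8 ∧ (0.504 : ℝ) * Real.log 3 ^ 9 < 1.23 := by
  have hlo := log_three_gt
  have hhi := log_three_lt
  have h0 : (0 : ℝ) ≤ Real.log 3 := by linarith
  constructor
  · have h : (1.091 : ℝ) ^ 8 < Real.log 3 ^ 8 := by gcongr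
    have h' : (2 : ℝ) < (1.091 : ℝ) ^ 8 := by norm_num
    linarith
  · have h : Real.log 3 ^ 9 < (1.1037 : ℝ) ^ 9 := by gcongr
    have h' : (0.504 : ℝ) * (1.1037 : ℝ) ^ 9 < 1.23 := by norm_num
    nlinarith

/-- `e^{a} < 4` for `a ≤ 1.23` (`e^{1.23} = e·e^{0.23} ≤ 2.7182818286/0.77 < 4`). [folklore] -/
private theorem exp_lt_four_of_le {a : ℝ} (ha : a ≤ 1.23) : Real.exp a < 4 := by
  have h1 : Real.exp 1 < 2.7182818286 := Real.exp_one_lt_d9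
  have h2 : (0.77 : ℝ) * Real.exp 0.23 ≤ 1 := by
    have h := Real.add_one_le_exp (-(0.23 : ℝ))
    rw [Real.exp_neg] at h
    have h' : (0.77 : ℝ) ≤ (Real.exp 0.23)⁻¹ := by linarith
    calc (0.77 : ℝ) * Real.exp 0.23 ≤ (Real.exp 0.23)⁻¹ * Real.exp 0.23 := by gcongr
      _ = 1 := inv_mul_cancel₀ (Real.exp_pos _).ne'
  have h3 : Real.exp a ≤ Real.exp 1.23 := Real.exp_le_exp.mpr ha
  have h4 : (1.23 : ℝ) = 1 + 0.23 := by norm_num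
  rw [h4, Real.exp_add] at h3
  nlinarith [Real.exp_pos (0.23 : ℝ), Real.exp_pos (1 : ℝ)]

/-- `P^{1/2} = e^{𝓛⁹/2}` and `P₁ = e^{0.504·𝓛⁹}` (`P = e^{𝓛⁹}`, (2.6), (2.21)).
[cite: Zhang2022LandauSiegel, §2 (2.6), (2.21)] -/
private theorem sqrtP_eq_and_P1_eq (D : ℕ) :
    bigP D ^ (1 / 2 : ℝ) = Real.exp (ell D ^ 9 * (1 / 2)) ∧
      Skeleton.P1 D = Real.exp (ell D ^ 9 * 0.504) := by
  refine ⟨?_, ?_⟩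
  · rw [bigP, ← Real.exp_mul]
  · rw [Skeleton.P1, bigP, ← Real.exp_mul]

/-- **The cut on `ϰ₁` never bites below `D⁴`**: if `P^{1/2} ≤ n < D⁴` then `P₁ ≤ n`, so `ϰ₁(n) = 0`
(`ϰ₁` is supported on `n < P₁ = P^{0.504}`, (8.6)). For `D ≥ 4` the hypothesis is void
(`D⁴ = e^{4𝓛} ≤ e^{𝓛⁹/2}`); for `D ≤ 3` it is checked from the sizes of `P`, `P₁`.
[cite: Zhang2022LandauSiegel, §8 (8.6), §15 (15.1)] -/
theorem vk1_eq_zero_of_sqrtP_le {D n : ℕ} (hD : D ≠ 0) (hP : bigP D ^ (1 / 2 : ℝ) ≤ (n : ℝ))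
    (hn : n < D ^ 4) : vk1 D n = 0 := by
  apply vk1_eq_zero
  obtain ⟨hsq, hP1⟩ := sqrtP_eq_and_P1_eq D
  rw [hsq] at hP
  rw [hP1]
  have hD0 : (0 : ℝ) < D := by exact_mod_cast Nat.pos_of_ne_zero hD
  have hnR : (n : ℝ) < (D : ℝ) ^ 4 := by exact_mod_cast hn
  have hD4 : (D : ℝ) ^ 4 = Real.exp (4 * ell D) := by
    rw [ell, show (4 : ℝ) * Real.log D = ((4 : ℕ) : ℝ) * Real.log D by norm_num,
      Real.exp_nat_mul, Real.exp_log hD0]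
  have hℓ0 : 0 ≤ ell D := by
    rw [ell]; exact Real.log_natCast_nonneg D
  -- `n ≥ 1`: `e^{𝓛⁹/2} ≥ 1`
  have hn1 : (1 : ℝ) ≤ n := le_trans (by
    have : (0 : ℝ) ≤ ell D ^ 9 * (1 / 2) := by positivity
    simpa using Real.one_le_exp this) hP
  by_cases h4 : 4 ≤ D
  · -- `D ≥ 4`: `𝓛 ≥ log 4 > 1.38`, `𝓛⁸ > 8`, so `D⁴ ≤ P^{1/2} ≤ n`, contradicting `n < D⁴`
    exfalso
    have hℓ : (1.38 : ℝ) ≤ ell D := by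
      have hlog4 : Real.log 4 ≤ ell D := by
        rw [ell]; exact Real.log_le_log (by norm_num) (by exact_mod_cast h4)
      have h42 : Real.log (4 : ℝ) = 2 * Real.log 2 := by
        rw [show (4 : ℝ) = 2 ^ 2 by norm_num, Real.log_pow]; norm_num
      have h2 := Real.log_two_gt_d9
      linarith
    have hℓ8 : (8 : ℝ) ≤ ell D ^ 8 := by
      have h : (1.38 : ℝ) ^ 8 ≤ ell D ^ 8 := by gcongr
      have h' : (8 : ℝ) ≤ (1.38 : ℝ) ^ 8 := by norm_num
      linarith
    have hexp : 4 * ell D ≤ ell D ^ 9 * (1 / 2) := by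
      have : ell D ^ 9 = ell D * ell D ^ 8 := by ring
      rw [this]
      nlinarith [mul_nonneg hℓ0 (by linarith : (0 : ℝ) ≤ ell D ^ 8 - 8)]
    have := Real.exp_le_exp.mpr hexp
    rw [← hD4] at this
    linarith
  · -- `D ≤ 3`
    have hD3 : D ≤ 3 := by omega
    have hD1 : 1 ≤ D := Nat.pos_of_ne_zero hD
    interval_cases D
    · -- `D = 1`: `𝓛 = 0`, `P₁ = 1 ≤ n`
      have h1 : ell 1 = 0 := by simp [ell]
      rw [h1]; simpa using hn1
    · -- `D = 2`: `𝓛 = log 2 < 1`, `P₁ ≤ e^{0.504} < 2 ≤ n`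
      have hℓ2 : ell 2 = Real.log 2 := by simp [ell]
      have hlt : Real.log 2 < 0.6931471808 := Real.log_two_lt_d9
      have hgt : 0.6931471803 < Real.log 2 := Real.log_two_gt_d9
      rw [hℓ2] at hP ⊢
      -- `n ≥ 2` since `n > e^{(log 2)⁹/2} > 1`... more precisely `n ≥ 1` and `n ≠ 1`:
      have hpos : 0 < Real.log 2 ^ 9 * (1 / 2) := by positivity
      have hn1' : (1 : ℝ) < n := lt_of_lt_of_le (by
        have := Real.add_one_le_exp (Real.log 2 ^ 9 * (1 / 2)); linarith) hP
      have hn2 : (2 : ℝ) ≤ n := by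
        have : 1 < n := by exact_mod_cast hn1'
        exact_mod_cast this
      have hle1 : Real.log 2 ^ 9 ≤ Real.log 2 := by
        calc Real.log 2 ^ 9 ≤ Real.log 2 ^ 1 :=
              pow_le_pow_of_le_one (by linarith) (by linarith) (by norm_num)
          _ = Real.log 2 := pow_one _
      have hexp : Real.exp (Real.log 2 ^ 9 * 0.504) < 2 := by
        have hx : Real.log 2 ^ 9 * 0.504 ≤ 0.35 := by nlinarith
        have h1' : Real.exp (Real.log 2 ^ 9 * 0.504) ≤ Real.exp 0.35 := Real.exp_le_exp.mpr hx
        have h2' : (0.65 : ℝ) * Real.exp 0.35 ≤ 1 := by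
          have h := Real.add_one_le_exp (-(0.35 : ℝ))
          rw [Real.exp_neg] at h
          have h' : (0.65 : ℝ) ≤ (Real.exp 0.35)⁻¹ := by linarith
          calc (0.65 : ℝ) * Real.exp 0.35 ≤ (Real.exp 0.35)⁻¹ * Real.exp 0.35 := by gcongr
            _ = 1 := inv_mul_cancel₀ (Real.exp_pos _).ne'
        nlinarith [Real.exp_pos (0.35 : ℝ)]
      linarith
    · -- `D = 3`: `e^{(log 3)⁹/2} > 3` so `n ≥ 4`, and `P₁ = e^{0.504(log 3)⁹} < 4`
      have hℓ3 : ell 3 = Real.log 3 := by simp [ell]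
      rw [hℓ3] at hP ⊢
      obtain ⟨h8, h9⟩ := log_three_pow_bounds
      have hlo := log_three_gt
      have hl0 : 0 < Real.log 3 := by linarith
      have hgt3 : (3 : ℝ) < Real.exp (Real.log 3 ^ 9 * (1 / 2)) := by
        have h : Real.log 3 < Real.log 3 ^ 9 * (1 / 2) := by
          have : Real.log 3 ^ 9 = Real.log 3 * Real.log 3 ^ 8 := by ring
          rw [this]
          nlinarith [mul_pos hl0 (by linarith : (0 : ℝ) < Real.log 3 ^ 8 - 2)]
        calc (3 : ℝ) = Real.exp (Real.log 3) := (Real.exp_log (by norm_num)).symm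
          _ < Real.exp (Real.log 3 ^ 9 * (1 / 2)) := Real.exp_lt_exp.mpr h
      have hn4 : (4 : ℝ) ≤ n := by
        have h3n : (3 : ℝ) < n := lt_of_lt_of_le hgt3 hP
        have : 3 < n := by exact_mod_cast h3n
        exact_mod_cast this
      have hP1lt : Real.exp (Real.log 3 ^ 9 * 0.504) < 4 :=
        exp_lt_four_of_le (by linarith)
      linarith

/-- The coefficient of `H₁₄ + ι₂H₁₂` with the cut `[n < P^{1/2}]` on `ϰ₁` agrees with the uncut
`ϰ₁ + ι₂ϰ₂` at every positive `n < D⁴`. [cite: Zhang2022LandauSiegel, §15 (15.1), §17 u006 p.96] -/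
theorem vk1_cut_eq_of_lt {D : ℕ} (hD : D ≠ 0) :
    ∀ m : ℕ, m ≠ 0 → m < D ^ 4 →
      (if (m : ℝ) < bigP D ^ (1 / 2 : ℝ) then vk1 D m else 0) + iota2 * vk2 D m =
        vk1 D m + iota2 * vk2 D m := by
  intro m _ hm
  split_ifs with h
  · rfl
  · rw [vk1_eq_zero_of_sqrtP_le hD (not_lt.mp h) hm]

/-! ## The node -/

/-- **`Z22:§17.u006` in the `N`-coefficient reading HOLDS** (§17 p. 96, tex L4732; GAP row G-L4t6-2,
reading of record `Step17_u006N`): for every modulus `D`, every Dirichlet character `χ` mod `D`, and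
every `1 ≤ n < D⁴`,
`ν*(n) = (κ₂ ∗ [χ(ϰ₁+ι₂ϰ₂)] ∗ [χ(ῑ₃ϰ₃+ῑ₄ϰ₄)] ∗ υ ∗ nN β₂ ∗ nN β₃)(n)`,
where `ν* = κ₂ ∗ (bχ) ∗ υ·[≤D⁴] ∗ nN β₂ ∗ nN β₃` is the typed coefficient sequence of
`(L(s+β₁,ψ)/L(s,ψ))B(s,ψ)G(s,ψ)N(s+β₂,ψ)N(s+β₃,ψ)` (§17.u004) and `ϰ₄ := ϰ₂` (`vk4`). Pure
bookkeeping: `b·χ = [χ(ϰ₁·[<P^{1/2}]+ι₂ϰ₂)] ∗ [χ(ῑ₃ϰ₃+ῑ₄ϰ₂)]` (`bcoef_eq_conv`), the cut and the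
truncation of `υ` are invisible at the divisors of `n < D⁴`, and convolution is associative.
[cite: Zhang2022LandauSiegel, §17 u006 p.96] -/
theorem step17_u006N_holds (c' : ℝ) {D : ℕ} [NeZero D] (χ : DirichletCharacter ℂ D) :
    Step17_u006N c' χ := by
  intro n hn1 hn4
  have hD : D ≠ 0 := NeZero.ne D
  have hn0 : n ≠ 0 := by omega
  -- the six coefficient sequences
  set K : ℕ → ℂ := fun n => MeanSquareMajorant.kappa₂ (b1 c' D) n with hK
  set A1 : ℕ → ℂ := fun n => χ (n : ZMod D) * (vk1 D n + iota2 * vk2 D n) with hA1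
  set A2 : ℕ → ℂ := fun n => χ (n : ZMod D) * (conj iota3 * vk3 D n + conj iota4 * vk4 D n)
    with hA2
  set Bχ : ℕ → ℂ := fun n => bcoef D n * χ (n : ZMod D) with hBχ
  set U : ℕ → ℂ := trunc (D ^ 4) (ups χ) with hU
  set N2 : ℕ → ℂ := nN D (beta2 c' D) with hN2
  set N3 : ℕ → ℂ := nN D (beta3 c' D) with hN3
  show ((((K ⍟ Bχ) ⍟ U) ⍟ N2) ⍟ N3) n = (((((K ⍟ A1) ⍟ A2) ⍟ ups χ) ⍟ N2) ⍟ N3) n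
  -- (i)+(ii): `bχ` agrees with `A1 ∗ A2` below `D⁴`
  have step1 : ∀ m : ℕ, m ≠ 0 → m < D ^ 4 → Bχ m = (A1 ⍟ A2) m := by
    intro m hm0 hm
    have htw := convolution_chi_mul χ (fun n => vk1 D n + iota2 * vk2 D n)
      (fun n => conj iota3 * vk3 D n + conj iota4 * vk4 D n)
    have hconv : (A1 ⍟ A2) m = χ (m : ZMod D) *
        ((fun n => vk1 D n + iota2 * vk2 D n) ⍟
          (fun n => conj iota3 * vk3 D n + conj iota4 * vk4 D n)) m := by
      rw [hA1, hA2]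
      exact congrFun htw m
    rw [hconv]
    show bcoef D m * χ (m : ZMod D) = _
    rw [mul_comm (bcoef D m), bcoef_eq_conv]
    congr 1
    exact convolution_apply_congr_of_lt (N := D ^ 4) (vk1_cut_eq_of_lt hD) (fun _ _ _ => rfl)
      m hm0 hm
  -- `κ₂ ∗ (bχ)` agrees with `(κ₂ ∗ A1) ∗ A2` below `D⁴`
  have step2 : ∀ m : ℕ, m ≠ 0 → m < D ^ 4 → (K ⍟ Bχ) m = ((K ⍟ A1) ⍟ A2) m := by
    intro m hm0 hm
    rw [convolution_assoc]
    exact convolution_apply_congr_of_lt (N := D ^ 4) (fun _ _ _ => rfl) step1 m hm0 hm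
  -- (iii): the truncation of `υ` is invisible below `D⁴`
  have step3 : ∀ m : ℕ, m ≠ 0 → m < D ^ 4 → U m = ups χ m := by
    intro m _ hm
    simp only [hU, trunc, if_pos hm.le]
  -- (iv): propagate through the two outer convolutions
  have step4 := convolution_apply_congr_of_lt (N := D ^ 4) step2 step3
  have step5 := convolution_apply_congr_of_lt (N := D ^ 4) step4
    (fun m _ _ => (rfl : N2 m = N2 m))
  exact convolution_apply_congr_of_lt (N := D ^ 4) step5 (fun m _ _ => (rfl : N3 m = N3 m)) n hn0 hn4

variable (c' : ℝ) {D : ℕ} (χ : DirichletCharacter ℂ D) in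
/-- `Step17_u006N` holds for EVERY modulus `D` (the def carries no `[NeZero D]`): for `D = 0` the range
`1 ≤ n < D⁴ = 0` is empty, so the statement is vacuous; for `D ≥ 1` it is `step17_u006N_holds` above.
Exact-name discharge of the named fact under its own parameters (appended 2026-08-28, D-0026 bookkeeping:
no statement, definition or attribute is edited; no new named fact). [cite: Zhang2022LandauSiegel, §17 u006 p.96] -/
theorem Step17_u006N_holds : Step17_u006N c' χ :=
  match D, χ with
  | 0, _ => fun _ _ hn4 => absurd hn4 (by simp)
  | _ + 1, χ => step17_u006N_holds c' χ

end Literature.NumberTheory.LFunctions.Zhang2022.Typed.Section17
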